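import Mathlib.Algebra.MvPolynomial.CommRing
import Mathlib.Algebra.MvPolynomial.Monad
import Mathlib.Algebra.CharZero.Defs
import Literature.Computability.AlgebraicComplexity.SparseCircuitBounds
import Literature.Computability.AlgebraicComplexity.IMMInVPProofs
import HarnessLib

/-!
# Lagrange indicator polynomials on an integer range (the interpolation gadget of KRST 2022, Claim 10)

Topic `Computability/AlgebraicComplexity`. Kumar–Ramya–Saptharishi–Tengse 2022, Claim 10 /
Observation 11: "for any `i, b, p` there exists a unique univariate polynomial `Q_{i,b,p}(v)` of
degree at most `b` such that `Q_{i,b,p}(a) = 1` if `0 ≤ a < b` and `a ≡ i (mod p)`, and `= 0` if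
`0 ≤ a < b` and `a ≢ i (mod p)`" (by interpolation), "computed by an algebraic circuit of size
`poly(b)`". This file provides the general gadget over a field of characteristic zero: for a range
bound `B` and a decidable predicate `P` on `ℕ`, a univariate polynomial taking the value `[P m]` at
every integer point `m ≤ B`, with degree `≤ B` and circuit complexity `≤ (B+1)(2B+2)`, together
with its composition with an arbitrary "argument" polynomial `v` (value `[P m]` wherever `v`
evaluates to the integer `m ≤ B`).

* `lagrangeNode F B w` — the Lagrange basis polynomial of the node `w` on `{0, …, B}`;
* `natIndicator F B P` — `Σ_{w ≤ B, P w} lagrangeNode F B w`; `eval_natIndicator`,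
  `totalDegree_natIndicator_le`, `complexity_natIndicator_le`;
* `natIndicatorAt F B P v` — the same composed with `v ∈ F[τ]`; `eval_natIndicatorAt`,
  `totalDegree_natIndicatorAt_le`, `complexity_natIndicatorAt_le`.

Characteristic zero is used only through the injectivity of `ℕ → F` (distinct nodes).

## References

* [KumarRamyaSaptharishiTengse2022] M. Kumar, C. Ramya, R. Saptharishi, A. Tengse, *If VNP is
  hard, then so are equations for it*, STACS 2022, Claim 10 and Observation 11.
-/

noncomputable section

namespace Literature.Computability.AlgebraicComplexity

open MvPolynomial Finset

variable (F : Type*) [Field F]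

/-- The Lagrange basis polynomial of the node `w` on the integer range `{0, …, B}`:
`ℓ_w(v) = ∏_{w' ≤ B, w' ≠ w} (w - w')⁻¹ (v - w')`. [cite: KumarRamyaSaptharishiTengse2022, Claim 10] -/
def lagrangeNode (B w : ℕ) : MvPolynomial (Fin 1) F :=
  ∏ w' ∈ (range (B + 1)).erase w, C (((w : F) - w')⁻¹) * (X 0 - C (w' : F))

/-- `ℓ_w(w) = 1`. [cite: KumarRamyaSaptharishiTengse2022, Claim 10] -/
theorem eval_lagrangeNode_self [CharZero F] (B w : ℕ) :
    eval (fun _ => (w : F)) (lagrangeNode F B w) = 1 := by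
  unfold lagrangeNode
  rw [eval_prod]
  refine Finset.prod_eq_one fun w' hw' => ?_
  have hne : (w : F) - w' ≠ 0 := by
    rw [sub_ne_zero]
    exact fun h => (Finset.mem_erase.1 hw').1 (Nat.cast_injective h).symm
  simp only [map_mul, eval_C, map_sub, eval_X]
  exact inv_mul_cancel₀ hne

/-- `ℓ_w(m) = 0` for an integer node `m ≤ B`, `m ≠ w`. [cite: KumarRamyaSaptharishiTengse2022, Claim 10] -/
theorem eval_lagrangeNode_of_ne {B w m : ℕ} (hm : m ≤ B) (hmw : m ≠ w) :
    eval (fun _ => (m : F)) (lagrangeNode F B w) = 0 := by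
  unfold lagrangeNode
  rw [eval_prod]
  refine Finset.prod_eq_zero (i := m) ?_ ?_
  · exact Finset.mem_erase.2 ⟨hmw, Finset.mem_range.2 (Nat.lt_succ_of_le hm)⟩
  · simp

/-- `deg ℓ_w ≤ B` for `w ≤ B` (a product of `B` linear factors). [cite: KumarRamyaSaptharishiTengse2022, Claim 10] -/
theorem totalDegree_lagrangeNode_le {B w : ℕ} (hw : w ≤ B) :
    (lagrangeNode F B w).totalDegree ≤ B := by
  unfold lagrangeNode
  refine (totalDegree_finsetProd _ _).trans ?_
  have hcard : ((range (B + 1)).erase w).card = B := by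
    rw [Finset.card_erase_of_mem (Finset.mem_range.2 (Nat.lt_succ_of_le hw)), Finset.card_range]
    rfl
  calc ∑ w' ∈ (range (B + 1)).erase w,
        (C (((w : F) - w')⁻¹) * (X 0 - C (w' : F)) : MvPolynomial (Fin 1) F).totalDegree
      ≤ ∑ _w' ∈ (range (B + 1)).erase w, 1 := by
        refine Finset.sum_le_sum fun w' _ => ?_
        refine (totalDegree_mul _ _).trans ?_
        rw [totalDegree_C, zero_add]
        refine (totalDegree_sub _ _).trans (max_le ?_ ?_)
        · exact (isHomogeneous_X F (0 : Fin 1)).totalDegree_le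
        · rw [totalDegree_C]; exact Nat.zero_le _
    _ = B := by rw [Finset.sum_const, smul_eq_mul, mul_one, hcard]

/-- **The indicator polynomial of a predicate `P` on `{0, …, B}`**: `Σ_{w ≤ B, P w} ℓ_w`
(KRST's `Q_{i,b,p}` is the case `P = (· ≡ i mod p)`). [cite: KumarRamyaSaptharishiTengse2022, Claim 10] -/
def natIndicator (B : ℕ) (P : ℕ → Prop) [DecidablePred P] : MvPolynomial (Fin 1) F :=
  ∑ w ∈ (range (B + 1)).filter P, lagrangeNode F B w

/-- **Interpolation property**: at every integer point `m ≤ B` the indicator takes the value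
`[P m]`. [cite: KumarRamyaSaptharishiTengse2022, Claim 10] -/
theorem eval_natIndicator [CharZero F] (B : ℕ) (P : ℕ → Prop) [DecidablePred P] {m : ℕ}
    (hm : m ≤ B) :
    eval (fun _ => (m : F)) (natIndicator F B P) = if P m then 1 else 0 := by
  unfold natIndicator
  rw [eval_sum]
  by_cases hP : P m
  · rw [if_pos hP, Finset.sum_eq_single m]
    · exact eval_lagrangeNode_self F B m
    · intro w _ hwm
      exact eval_lagrangeNode_of_ne F hm (Ne.symm hwm)
    · intro h
      exact absurd (Finset.mem_filter.2 ⟨Finset.mem_range.2 (Nat.lt_succ_of_le hm), hP⟩) h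
  · rw [if_neg hP]
    refine Finset.sum_eq_zero fun w hw => ?_
    exact eval_lagrangeNode_of_ne F hm (fun h => hP (h ▸ (Finset.mem_filter.1 hw).2))

/-- `deg ≤ B`. [cite: KumarRamyaSaptharishiTengse2022, Claim 10] -/
theorem totalDegree_natIndicator_le (B : ℕ) (P : ℕ → Prop) [DecidablePred P] :
    (natIndicator F B P).totalDegree ≤ B := by
  unfold natIndicator
  refine (totalDegree_finsetSum _ _).trans (Finset.sup_le fun w hw => ?_)
  exact totalDegree_lagrangeNode_le F
    (Nat.le_of_lt_succ (Finset.mem_range.1 (Finset.mem_filter.1 hw).1))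

/-- **Size `poly(B)`** (KRST Observation 11: "computed by an algebraic circuit of size
`poly(b)`"): `L ≤ (B+1)(2B+2)`, as a univariate polynomial of degree `≤ B`.
[cite: KumarRamyaSaptharishiTengse2022, Observation 11] -/
theorem complexity_natIndicator_le (B : ℕ) (P : ℕ → Prop) [DecidablePred P] :
    complexity (natIndicator F B P) ≤ (B + 1) * (2 * B + 2) := by
  have hd := totalDegree_natIndicator_le F B P
  calc complexity (natIndicator F B P)
      ≤ ((natIndicator F B P).totalDegree + 1) ^ Fintype.card (Fin 1) *
          (2 * (natIndicator F B P).totalDegree + 2) := complexity_le_pow_card _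
    _ ≤ (B + 1) ^ Fintype.card (Fin 1) * (2 * B + 2) := by gcongr
    _ = (B + 1) * (2 * B + 2) := by simp

section At

variable {F} {τ : Type*}

/-- The indicator composed with an argument polynomial `v ∈ F[τ]`: `[P](v)`.
[cite: KumarRamyaSaptharishiTengse2022, Observation 11] -/
def natIndicatorAt (B : ℕ) (P : ℕ → Prop) [DecidablePred P] (v : MvPolynomial τ F) :
    MvPolynomial τ F :=
  aeval (fun _ : Fin 1 => v) (natIndicator F B P)

/-- **Value of the composed indicator**: if `v` evaluates to the integer `m ≤ B` at `x`, then
`[P](v)` evaluates to `[P m]`. [cite: KumarRamyaSaptharishiTengse2022, Observation 11] -/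
theorem eval_natIndicatorAt [CharZero F] (B : ℕ) (P : ℕ → Prop) [DecidablePred P]
    {v : MvPolynomial τ F}
    {x : τ → F} {m : ℕ} (hv : eval x v = (m : F)) (hm : m ≤ B) :
    eval x (natIndicatorAt B P v) = if P m then 1 else 0 := by
  unfold natIndicatorAt
  rw [aeval_eq_bind₁, show eval x (bind₁ (fun _ : Fin 1 => v) (natIndicator F B P)) =
      eval (fun i => eval x ((fun _ : Fin 1 => v) i)) (natIndicator F B P) from
    eval₂Hom_bind₁ _ _ _ _]
  simp only [hv]
  exact eval_natIndicator F B P hm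

/-- Size of the composed indicator: `≤ (B+1)(2B+2) + L(v)` (substitution, Bürgisser Rem. 2.7).
[cite: KumarRamyaSaptharishiTengse2022, Observation 11] -/
theorem complexity_natIndicatorAt_le (B : ℕ) (P : ℕ → Prop) [DecidablePred P]
    (v : MvPolynomial τ F) :
    complexity (natIndicatorAt B P v) ≤ (B + 1) * (2 * B + 2) + complexity v := by
  unfold natIndicatorAt
  refine (complexity_aeval_le _ _).trans ?_
  rw [Fintype.sum_unique]
  exact Nat.add_le_add_right (complexity_natIndicator_le F B P) _

/-- Degree of the composed indicator: `≤ B · deg v`. [cite: KumarRamyaSaptharishiTengse2022, Observation 11] -/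
theorem totalDegree_natIndicatorAt_le (B : ℕ) (P : ℕ → Prop) [DecidablePred P]
    (v : MvPolynomial τ F) :
    (natIndicatorAt B P v).totalDegree ≤ B * v.totalDegree := by
  unfold natIndicatorAt
  refine (Literature.RingTheory.Nullstellensatz.totalDegree_aeval_le _ (fun _ => le_rfl) _).trans ?_
  exact Nat.mul_le_mul_right _ (totalDegree_natIndicator_le F B P)

end At

end Literature.Computability.AlgebraicComplexity

end
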